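import Mathlib
import Literature.NumberTheory.Transcendental.KZCalculus
import Literature.NumberTheory.Transcendental.KZHomotopyMoves
import Literature.NumberTheory.Transcendental.KZProductIdeal
import Literature.NumberTheory.Transcendental.KZLogCalculusProofs
import Literature.NumberTheory.Transcendental.KZDominatedFamilyRelations
import Literature.NumberTheory.Transcendental.KZTorusLogRep
import Summits.KontsevichZagierPeriods.KontsevichZagierPeriods.Theses.UnfoldedStokes
import Summits.KontsevichZagierPeriods.KontsevichZagierPeriods.Theorems.UnfoldedStokesHyperellipticRiemannRelationStubEngineAux

/-!
# `HyperellipticRiemannRelation` (stmt-KontsevichZagierPeriods-3522), line `SketchIdeator2`: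
# stub `stub_engine` — the fibred half-plane transport engine

Registered stub `stub_engine` of the line skeleton: the ABSTRACT two-move engine of the line, pure
move hygiene inside the Kontsevich–Zagier calculus (`KZCalculus.lean`), no complex analysis.
Coordinates `w = (a, τ, σ) ∈ ℝ³` (`a ∈ A` a spectator, `τ ∈ ℝ` the transport direction,
`σ ∈ [0,1]` the compactified height). Data: a base `D ⊆ A × ℝ` of full measure, a
height-primitive `V` (`∂_σ V = B` on the open fibres, `V(·,1) = 0`), the bulk `B` (semialgebraic
and absolutely integrable on the open prism `Ω = A × ℝ × (0,1)`) and an abscissa-primitive `U`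
(`∂_τ U = B`, `U → 0` as `τ → ±∞`). Claim: the bottom face `[D, V(·,·,0)]` is a relation.

Chain of moves (value level: `∫_D V(·,0) = −∫_Ω B = −∫_{A×(0,1)} ∫_ℝ ∂_τ U dτ = 0`):

* (i) ONE Newton–Leibniz move along `σ` over `D` (rule (3), primitive `V`, band integrand `B`
  extended by zero to the closed band `D × [0,1]`) lands on `[D, V(·,1) − V(·,0)] = −[F]`
  (rule (1b), `KZ.of_add_of_mem_relations_of_eqOn_neg`);
* (ii) the closed band, the open band and the prism `Ω` differ by null sets (the faces
  `σ ∈ {0,1}`: `KZ.of_sub_of_restrict_openBand_mem_relations`; the cylinder over `(A × ℝ) \ D`: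
  `KZ.volume_setOf_init_mem_eq_zero`, `KZ.IntegralRep.of_sub_of_restrict_mem_relations`);
* (iii) the coordinate transposition `(a,τ,σ) ↦ (a,σ,τ)` is a move (`KZ.of_sub_of_reindex_mem_relations`);
* (iv) the compactification `τ = c ρ = (1−ρ)⁻¹ − ρ⁻¹`, `ρ ∈ (0,1)`, is ONE change of variables
  (rule (2), `Engine.exists_lastSubst`);
* (v) ONE Newton–Leibniz move along `ρ` over `A × (0,1)` with the primitive `U(a, c ρ, σ)`, which
  tends to `0` at both ends, lands on a zero representation
  (`stub_engineAux`, the registered auxiliary stub of the sibling file).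

All sets are written out; no definitions are introduced; the general move lemmas are in the
sibling file `UnfoldedStokesHyperellipticRiemannRelationStubEngineAux.lean`.
References: Kontsevich–Zagier 2001, §1.2 rules (1)–(3); Bochnak–Coste–Roy 1998, §2.2.
-/

noncomputable section

namespace Summit.KontsevichZagierPeriods.UnfoldedStokes.HyperellipticRiemannRelationLine

open Set MeasureTheory Filter Topology
open Literature.NumberTheory.Transcendental
open Literature.ModelTheory.ExponentialFields (IsSemialgebraic)

namespace Engine

/-! ## Vector bookkeeping on `ℝ³` (`Fin.init w = ![w 0, w 1]` is `KZ.init_fin_three`) -/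

/-- `snoc (x₀, x₁) t = (x₀, x₁, t)`. [folklore] -/
theorem snoc_eq (x : Fin 2 → ℝ) (t : ℝ) : (Fin.snoc x t : Fin 3 → ℝ) = ![x 0, x 1, t] := by
  ext i
  fin_cases i <;> rfl

/-- Reading a vector of `ℝ³` through the transposition of the coordinates `1` and `2`. [folklore] -/
theorem swap_eq (w : Fin 3 → ℝ) :
    (fun i => w (Equiv.swap (1 : Fin 3) 2 i)) = ![w 0, w 2, w 1] := by
  ext i
  fin_cases i <;> rfl

/-! ## Semialgebraic prisms -/

/-- The prism `{w | w i ∈ A, 0 < w j < 1} ⊆ ℝⁿ` over a `ℚ`-semialgebraic `A ⊆ ℝ` is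
`ℚ`-semialgebraic (a coordinate preimage and two polynomial inequalities). [folklore] -/
theorem isSemialgebraic_prism {n : ℕ} {A : Set ℝ}
    (hA : IsSemialgebraic ℚ {t : Fin 1 → ℝ | t 0 ∈ A}) (i j : Fin n) :
    IsSemialgebraic ℚ {w : Fin n → ℝ | w i ∈ A ∧ 0 < w j ∧ w j < 1} := by
  have h1 : IsSemialgebraic ℚ {w : Fin n → ℝ | w i ∈ A} := hA.preimage_comp fun _ : Fin 1 => i
  have h2 := Literature.ModelTheory.ExponentialFields.isSemialgebraic_setOf_eval_pos (k := ℚ)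
    (R := ℝ) (MvPolynomial.X j : MvPolynomial (Fin n) ℚ)
  have h3 := Literature.ModelTheory.ExponentialFields.isSemialgebraic_setOf_eval_lt (k := ℚ)
    (R := ℝ) (MvPolynomial.X j : MvPolynomial (Fin n) ℚ) 1
  simp only [MvPolynomial.aeval_X, map_one] at h2 h3
  convert h1.inter (h2.inter h3) using 1
  ext w
  simp only [mem_setOf_eq, mem_inter_iff]

/-! ## The compactification `c t = (1 − t)⁻¹ − t⁻¹`: positivity and semialgebraicity -/

/-- `c' t = (1 − t)⁻² + t⁻² > 0` on `(0,1)`. [folklore] -/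
theorem compactify_deriv_pos {t : ℝ} (ht : t ∈ Ioo (0:ℝ) 1) :
    0 < ((1 - t) ^ 2)⁻¹ + (t ^ 2)⁻¹ := by
  have h0 : 0 < t := ht.1
  have h1 : 0 < 1 - t := sub_pos.2 ht.2
  positivity

/-- The open unit interval, as a subset of `ℝ¹`, is `ℚ`-semialgebraic. [folklore] -/
theorem isSemialgebraic_Ioo_fin_one : IsSemialgebraic ℚ {p : Fin 1 → ℝ | p 0 ∈ Ioo (0:ℝ) 1} :=
  isSemialgebraic_unitInterval_fin_one

/-- `p ↦ c (p 0)` is a `ℚ`-semialgebraic function on every `ℚ`-semialgebraic `s ⊆ ℝ¹` (a rational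
function; Mathlib's junk value `0⁻¹ = 0` included). [cite: BochnakCosteRoy1998, Prop. 2.2.6] -/
theorem isSemialgebraicFunOn_compactify {s : Set (Fin 1 → ℝ)} (hs : IsSemialgebraic ℚ s) :
    IsSemialgebraicFunOn ℚ s (fun p => (1 - p 0)⁻¹ - (p 0)⁻¹) := by
  have h1 : IsSemialgebraicFunOn ℚ s (fun p => (1:ℝ) - p 0) := by
    simpa using (isSemialgebraicFunOn_ratCast hs 1).fun_sub (isSemialgebraicFunOn_apply hs 0)
  exact h1.fun_inv.fun_sub (isSemialgebraicFunOn_apply hs 0).fun_inv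

/-- `p ↦ c' (p 0)` is a `ℚ`-semialgebraic function on every `ℚ`-semialgebraic `s ⊆ ℝ¹`.
[cite: BochnakCosteRoy1998, Prop. 2.2.6] -/
theorem isSemialgebraicFunOn_compactify_deriv {s : Set (Fin 1 → ℝ)} (hs : IsSemialgebraic ℚ s) :
    IsSemialgebraicFunOn ℚ s (fun p => ((1 - p 0) ^ 2)⁻¹ + ((p 0) ^ 2)⁻¹) := by
  have h1 : IsSemialgebraicFunOn ℚ s (fun p => (1:ℝ) - p 0) := by
    simpa using (isSemialgebraicFunOn_ratCast hs 1).fun_sub (isSemialgebraicFunOn_apply hs 0)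
  exact (h1.fun_pow 2).fun_inv.fun_add ((isSemialgebraicFunOn_apply hs 0).fun_pow 2).fun_inv

/-! ## Steps (iii)–(v): the bulk `[Ω, B]` is a relation -/

/-- **The bulk is a relation.** For `B`, `U` as in the engine (`U` `ℚ`-semialgebraic on the prism
`Ω = {w | w 0 ∈ A, 0 < w 2 < 1}`, `∂_τ U = B` along the middle coordinate, `U → 0` at `τ → ±∞`)
every representation `R = [Ω, B]` is a relation: transpose the last two coordinates (rule (2)),
compactify the (now last) coordinate `τ = (1−ρ)⁻¹ − ρ⁻¹` (rule (2)), and apply ONE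
Newton–Leibniz move along `ρ` whose primitive `U(a, c ρ, σ)` vanishes at both ends (rule (3)).
[cite: KontsevichZagier2001, §1.2 rules (2), (3)] -/
theorem of_bulk_mem_relations (A : Set ℝ) (U B : (Fin 3 → ℝ) → ℝ)
    (hA : IsSemialgebraic ℚ {t : Fin 1 → ℝ | t 0 ∈ A})
    (hU : IsSemialgebraicFunOn ℚ {w : Fin 3 → ℝ | w 0 ∈ A ∧ 0 < w 2 ∧ w 2 < 1} U)
    (hUfib : ∀ a ∈ A, ∀ σ ∈ Ioo (0:ℝ) 1,
        (∀ τ : ℝ, HasDerivAt (fun τ : ℝ => U ![a, τ, σ]) (B ![a, τ, σ]) τ) ∧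
        Tendsto (fun τ : ℝ => U ![a, τ, σ]) atTop (𝓝 0) ∧
        Tendsto (fun τ : ℝ => U ![a, τ, σ]) atBot (𝓝 0))
    (R : KZ.IntegralRep 3) (hRd : R.domain = {w : Fin 3 → ℝ | w 0 ∈ A ∧ 0 < w 2 ∧ w 2 < 1})
    (hRi : R.integrand = B) : KZ.of R ∈ KZ.relations := by
  -- (iii) transpose the coordinates `1` and `2`: `τ` becomes the last coordinate
  have hre : KZ.of R - KZ.of (R.reindex (Equiv.swap (1 : Fin 3) 2)) ∈ KZ.relations :=
    KZ.of_sub_of_reindex_mem_relations R _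
  have hZ : IsSemialgebraic ℚ {z : Fin 2 → ℝ | z 0 ∈ A ∧ 0 < z 1 ∧ z 1 < 1} :=
    isSemialgebraic_prism hA 0 1
  have hR'd : (R.reindex (Equiv.swap (1 : Fin 3) 2)).domain =
      {z : Fin 3 → ℝ | Fin.init z ∈ {z : Fin 2 → ℝ | z 0 ∈ A ∧ 0 < z 1 ∧ z 1 < 1} ∧
        z (Fin.last 2) ∈ (fun s : ℝ => (1 - s)⁻¹ - s⁻¹) '' Ioo (0:ℝ) 1} := by
    rw [image_compactify, KZ.IntegralRep.reindex_domain, hRd]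
    ext w
    simp [swap_eq, KZ.init_fin_three]
  -- (iv) compactify `τ = c ρ`
  obtain ⟨r, hrd, hri, hcov⟩ := exists_lastSubst hZ isSemialgebraic_Ioo_fin_one
    (fun s : ℝ => (1 - s)⁻¹ - s⁻¹) (fun s : ℝ => ((1 - s) ^ 2)⁻¹ + (s ^ 2)⁻¹)
    (isSemialgebraicFunOn_compactify isSemialgebraic_Ioo_fin_one)
    (isSemialgebraicFunOn_compactify_deriv isSemialgebraic_Ioo_fin_one)
    (fun t ht => hasDerivAt_compactify ht) (fun t ht => compactify_deriv_pos ht)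
    strictMonoOn_compactify.injOn rfl (R.reindex (Equiv.swap (1 : Fin 3) 2)) hR'd
  -- (v) Newton–Leibniz along `ρ`, primitive `U` read through the two substitutions
  have hfib : ∀ (y : Fin 2 → ℝ) (s : ℝ),
      (fun i => (Fin.snoc (Fin.init (Fin.snoc y s : Fin 3 → ℝ))
        ((1 - (Fin.snoc y s : Fin 3 → ℝ) (Fin.last 2))⁻¹ -
          ((Fin.snoc y s : Fin 3 → ℝ) (Fin.last 2))⁻¹) : Fin 3 → ℝ)
        (Equiv.swap (1 : Fin 3) 2 i)) = ![y 0, (1 - s)⁻¹ - s⁻¹, y 1] := by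
    intro y s
    rw [Fin.init_snoc, Fin.snoc_last, swap_eq, snoc_eq]
    simp
  have hfun : ∀ y : Fin 2 → ℝ,
      (fun s : ℝ => U (fun i => (Fin.snoc (Fin.init (Fin.snoc y s : Fin 3 → ℝ))
        ((1 - (Fin.snoc y s : Fin 3 → ℝ) (Fin.last 2))⁻¹ -
          ((Fin.snoc y s : Fin 3 → ℝ) (Fin.last 2))⁻¹) : Fin 3 → ℝ)
        (Equiv.swap (1 : Fin 3) 2 i))) = fun s => U ![y 0, (1 - s)⁻¹ - s⁻¹, y 1] :=
    fun y => funext fun s => by rw [hfib]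
  have hr : KZ.of r ∈ KZ.relations := by
    refine stub_engineAux hZ r hrd
      (fun z => U (fun i => (Fin.snoc (Fin.init z)
        ((1 - z (Fin.last 2))⁻¹ - (z (Fin.last 2))⁻¹) : Fin 3 → ℝ) (Equiv.swap (1 : Fin 3) 2 i)))
      ?_ (fun y hy t ht => ?_) (fun y hy => ?_) (fun y hy => ?_)
    · -- the primitive is semialgebraic on the open band
      have hU' := hU.comp_equiv (Equiv.swap (1 : Fin 3) 2)
      have hΨ := isSemialgebraicMapOn_lastSubst hZ isSemialgebraic_Ioo_fin_one
        (fun s : ℝ => (1 - s)⁻¹ - s⁻¹) (isSemialgebraicFunOn_compactify isSemialgebraic_Ioo_fin_one)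
      rw [hrd]
      have hmaps : MapsTo (fun z : Fin 3 → ℝ => (Fin.snoc (Fin.init z)
          ((1 - z (Fin.last 2))⁻¹ - (z (Fin.last 2))⁻¹) : Fin 3 → ℝ))
          {z : Fin 3 → ℝ | Fin.init z ∈ {z : Fin 2 → ℝ | z 0 ∈ A ∧ 0 < z 1 ∧ z 1 < 1} ∧
            z (Fin.last 2) ∈ Ioo (0:ℝ) 1}
          {w : Fin 3 → ℝ | (fun i => w (Equiv.swap (1 : Fin 3) 2 i)) ∈
            {w : Fin 3 → ℝ | w 0 ∈ A ∧ 0 < w 2 ∧ w 2 < 1}} := by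
        intro z hz
        show (fun i => (Fin.snoc (Fin.init z) ((1 - z (Fin.last 2))⁻¹ - (z (Fin.last 2))⁻¹) :
          Fin 3 → ℝ) (Equiv.swap (1 : Fin 3) 2 i)) ∈ {w : Fin 3 → ℝ | w 0 ∈ A ∧ 0 < w 2 ∧ w 2 < 1}
        rw [swap_eq, snoc_eq]
        simpa using hz.1
      have hcomp := IsSemialgebraicFunOn.comp_isSemialgebraicMapOn_holds hU' hΨ hmaps
      exact hcomp
    · -- derivative along `ρ` (chain rule)
      have hval : r.integrand (Fin.snoc y t) =
          B ![y 0, (1 - t)⁻¹ - t⁻¹, y 1] * (((1 - t) ^ 2)⁻¹ + (t ^ 2)⁻¹) := by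
        rw [hri]
        show (R.reindex (Equiv.swap (1 : Fin 3) 2)).integrand _ * _ = _
        rw [KZ.IntegralRep.reindex_integrand, hRi]
        show B _ * _ = _
        rw [hfib, Fin.snoc_last]
      rw [hfun y, hval]
      exact ((hUfib (y 0) hy.1 (y 1) ⟨hy.2.1, hy.2.2⟩).1 _).comp t (hasDerivAt_compactify ht)
    · -- limit at `ρ → 0⁺` (`τ → −∞`)
      rw [hfun y]
      exact (hUfib (y 0) hy.1 (y 1) ⟨hy.2.1, hy.2.2⟩).2.2.comp tendsto_compactify_zero
    · -- limit at `ρ → 1⁻` (`τ → +∞`)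
      rw [hfun y]
      exact (hUfib (y 0) hy.1 (y 1) ⟨hy.2.1, hy.2.2⟩).2.1.comp tendsto_compactify_one
  have : KZ.of R = (KZ.of R - KZ.of (R.reindex (Equiv.swap (1 : Fin 3) 2))) -
      (KZ.of r - KZ.of (R.reindex (Equiv.swap (1 : Fin 3) 2))) + KZ.of r := by abel
  rw [this]
  exact KZ.relations.add_mem (KZ.relations.sub_mem hre hcov) hr

/-! ## Steps (i)–(ii): the face `[D, V(·,·,0)]` versus the bulk -/

/-- **The bottom face differs from the bulk by relations.** With the data of the engine, ONE
Newton–Leibniz move along `σ` over `D` (rule (3), primitive `V`, band integrand `B` extended by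
zero to the closed band `D × [0,1]`) gives `[D × [0,1], B] + [F] ∈ relations` (`V(·,1) = 0`, so
the base integrand is `−F.integrand`); the closed band, the open band `D × (0,1)` and the prism
`Ω = {w | w 0 ∈ A, 0 < w 2 < 1}` differ by null sets (two faces and the cylinder over the null
set `(A × ℝ) \ D`; rule (1)). Hence `[F]` is a relation as soon as `[Ω, B]` is one.
[cite: KontsevichZagier2001, §1.2 rules (1), (3)] -/
theorem of_face_mem_relations_of_bulk (A : Set ℝ) (D : Set (Fin 2 → ℝ))
    (V B : (Fin 3 → ℝ) → ℝ) (hA : IsSemialgebraic ℚ {t : Fin 1 → ℝ | t 0 ∈ A})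
    (hD : IsSemialgebraic ℚ D) (hDA : D ⊆ {y : Fin 2 → ℝ | y 0 ∈ A})
    (hnull : volume ({y : Fin 2 → ℝ | y 0 ∈ A} \ D) = 0)
    (hV : IsSemialgebraicFunOn ℚ
      {w : Fin 3 → ℝ | (![w 0, w 1] : Fin 2 → ℝ) ∈ D ∧ 0 ≤ w 2 ∧ w 2 ≤ 1} V)
    (hVfib : ∀ y ∈ D, ContinuousOn (fun σ : ℝ => V ![y 0, y 1, σ]) (Icc 0 1) ∧
      V ![y 0, y 1, 1] = 0 ∧
      ∀ σ ∈ Ioo (0:ℝ) 1, HasDerivAt (fun σ : ℝ => V ![y 0, y 1, σ]) (B ![y 0, y 1, σ]) σ)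
    (R : KZ.IntegralRep 3) (hRd : R.domain = {w : Fin 3 → ℝ | w 0 ∈ A ∧ 0 < w 2 ∧ w 2 < 1})
    (hRi : R.integrand = B) (hR : KZ.of R ∈ KZ.relations)
    (F : KZ.IntegralRep 2) (hFd : F.domain = D)
    (hFi : EqOn F.integrand (fun y => V ![y 0, y 1, 0]) D) :
    KZ.of F ∈ KZ.relations := by
  have hΩ : IsSemialgebraic ℚ {w : Fin 3 → ℝ | w 0 ∈ A ∧ 0 < w 2 ∧ w 2 < 1} :=
    isSemialgebraic_prism hA 0 2
  have hΩm : MeasurableSet {w : Fin 3 → ℝ | w 0 ∈ A ∧ 0 < w 2 ∧ w 2 < 1} :=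
    IsSemialgebraic.measurableSet_holds hΩ
  have ha : IsSemialgebraicFunOn ℚ D (fun _ => (0:ℝ)) := by
    simpa using isSemialgebraicFunOn_ratCast hD 0
  have hb : IsSemialgebraicFunOn ℚ D (fun _ => (1:ℝ)) := by
    simpa using isSemialgebraicFunOn_ratCast hD 1
  have hband : IsSemialgebraic ℚ (KZlog.band D (fun _ => 0) (fun _ => 1)) :=
    KZlog.isSemialgebraic_band ha hb
  have hmem_band : ∀ w : Fin 3 → ℝ, w ∈ KZlog.band D (fun _ => 0) (fun _ => 1) ↔
      (![w 0, w 1] : Fin 2 → ℝ) ∈ D ∧ 0 ≤ w 2 ∧ w 2 ≤ 1 := by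
    intro w
    rw [KZlog.mem_band, KZ.init_fin_three]
    rfl
  have hsnoc_mem : ∀ y ∈ D, ∀ t ∈ Ioo (0:ℝ) 1,
      (Fin.snoc y t : Fin 3 → ℝ) ∈ {w : Fin 3 → ℝ | w 0 ∈ A ∧ 0 < w 2 ∧ w 2 < 1} := by
    intro y hy t ht
    rw [snoc_eq]
    simpa using ⟨hDA hy, ht.1, ht.2⟩
  -- the band integrand: `B` extended by zero off the prism
  set G : (Fin 3 → ℝ) → ℝ := {w : Fin 3 → ℝ | w 0 ∈ A ∧ 0 < w 2 ∧ w 2 < 1}.indicator B with hG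
  have hGsa : IsSemialgebraicFunOn ℚ (KZlog.band D (fun _ => 0) (fun _ => 1)) G := by
    have h1 : IsSemialgebraicFunOn ℚ
        (KZlog.band D (fun _ => 0) (fun _ => 1) ∩ {w : Fin 3 → ℝ | w 0 ∈ A ∧ 0 < w 2 ∧ w 2 < 1})
        B := by
      have h := R.isSemialgebraicFunOn_integrand
      rw [hRd, hRi] at h
      exact h.mono inter_subset_right (hband.inter hΩ)
    have h0 : IsSemialgebraicFunOn ℚ
        (KZlog.band D (fun _ => 0) (fun _ => 1) \ {w : Fin 3 → ℝ | w 0 ∈ A ∧ 0 < w 2 ∧ w 2 < 1})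
        (fun _ => (0:ℝ)) := by
      simpa using isSemialgebraicFunOn_ratCast (hband.diff hΩ) 0
    have h := IsSemialgebraicFunOn.union h1 h0 (fun w hw => indicator_of_mem hw.2 B)
      (fun w hw => indicator_of_notMem hw.2 B)
    rwa [inter_union_sdiff] at h
  have hGint : IntegrableOn G (KZlog.band D (fun _ => 0) (fun _ => 1)) := by
    have h := R.integrableOn
    rw [hRd, hRi] at h
    exact ((integrable_indicator_iff hΩm).2 h).integrableOn
  let Rb : KZ.IntegralRep 3 := ⟨KZlog.band D (fun _ => 0) (fun _ => 1), G, hband, hGsa, hGint⟩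
  -- (i) rule (3) along `σ`, primitive `V`, base `[D, V(·,1) − V(·,0)] = F.neg`
  have hNL : KZ.of Rb - KZ.of F.neg ∈ KZ.relations := by
    refine KZ.newtonLeibnizRel_subset_relations ⟨2, Rb, F.neg, fun _ => 0, fun _ => 1, V, ?_,
      ?_, ?_, fun _ _ => zero_le_one, ?_, fun y hy => ?_, fun y hy t ht => ?_, fun y hy => ?_, rfl⟩
    · show IsSemialgebraicFunOn ℚ (KZlog.band D (fun _ => 0) (fun _ => 1)) V
      rw [Set.ext hmem_band]
      exact hV
    · rw [KZ.IntegralRep.domain_neg, hFd]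
      exact ha
    · rw [KZ.IntegralRep.domain_neg, hFd]
      exact hb
    · rw [KZ.IntegralRep.domain_neg, hFd]
      rfl
    · rw [KZ.IntegralRep.domain_neg, hFd] at hy
      show ContinuousOn (fun t : ℝ => V (Fin.snoc y t)) (Icc 0 1)
      simp only [snoc_eq]
      exact (hVfib y hy).1
    · rw [KZ.IntegralRep.domain_neg, hFd] at hy
      show HasDerivAt (fun s : ℝ => V (Fin.snoc y s)) (G (Fin.snoc y t)) t
      rw [hG, indicator_of_mem (hsnoc_mem y hy t ht)]
      simp only [snoc_eq]
      exact (hVfib y hy).2.2 t ht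
    · rw [KZ.IntegralRep.domain_neg, hFd] at hy
      show -F.integrand y = V (Fin.snoc y 1) - V (Fin.snoc y 0)
      rw [hFi hy, snoc_eq, snoc_eq, (hVfib y hy).2.1, zero_sub]
  have hFneg : KZ.of F + KZ.of F.neg ∈ KZ.relations :=
    KZ.of_add_of_mem_relations_of_eqOn_neg rfl fun _ _ => rfl
  -- (ii) closed band → open band → prism (null faces, null cylinder over `(A × ℝ) \ D`)
  obtain ⟨r₁, hr₁d, hr₁i, hr₁⟩ := KZ.of_sub_of_restrict_openBand_mem_relations (B := D)
    (a := fun _ => (0:ℝ)) (b := fun _ => (1:ℝ)) ha hb Rb rfl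
  have hsub : r₁.domain ⊆ R.domain := by
    rw [hr₁d, hRd]
    rintro z ⟨hzD, hz0, hz1⟩
    have h := hsnoc_mem (Fin.init z) hzD (z (Fin.last 2)) ⟨hz0, hz1⟩
    rwa [Fin.snoc_init_self] at h
  have hvol : volume (R.domain \ r₁.domain) = 0 := by
    refine measure_mono_null ?_ (KZ.volume_setOf_init_mem_eq_zero hnull)
    rw [hr₁d, hRd]
    rintro z ⟨⟨hzA, hz0, hz1⟩, hz⟩
    refine ⟨?_, fun hzD => hz ⟨hzD, hz0, hz1⟩⟩
    show z (Fin.castSucc 0) ∈ A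
    simpa using hzA
  have h3 := R.of_sub_of_restrict_mem_relations r₁.isSemialgebraic_domain hsub hvol
  have h4 : KZ.of r₁ - KZ.of (R.restrict r₁.domain r₁.isSemialgebraic_domain hsub) ∈
      KZ.relations := by
    refine KZ.of_sub_of_mem_relations_of_eqOn rfl fun z hz => ?_
    rw [hr₁i, KZ.IntegralRep.integrand_restrict, hRi]
    show G z = B z
    have hz' : z ∈ {w : Fin 3 → ℝ | w 0 ∈ A ∧ 0 < w 2 ∧ w 2 < 1} := hRd ▸ hsub hz
    rw [hG, indicator_of_mem hz']
  have : KZ.of F = (KZ.of F + KZ.of F.neg) + (KZ.of Rb - KZ.of F.neg) - (KZ.of Rb - KZ.of r₁)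
      - (KZ.of r₁ - KZ.of (R.restrict r₁.domain r₁.isSemialgebraic_domain hsub))
      + (KZ.of R - KZ.of (R.restrict r₁.domain r₁.isSemialgebraic_domain hsub)) - KZ.of R := by
    abel
  rw [this]
  exact KZ.relations.sub_mem (KZ.relations.add_mem (KZ.relations.sub_mem (KZ.relations.sub_mem
    (KZ.relations.add_mem hFneg hNL) hr₁) h4) h3) hR

end Engine

/-! ## The registered stub -/

/-- **Fibred half-plane transport engine.** Coordinates `w = (a, τ, σ) ∈ ℝ³`: `a` a spectator
ranging in `A ⊆ ℝ`, `τ ∈ ℝ` the transport direction, `σ ∈ [0,1]` the (compactified) height.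
Data: a base `D ⊆ A × ℝ` of full measure, a height-primitive `V` (semialgebraic on the closed band
`D × [0,1]`, continuous on each closed fibre, vanishing at `σ = 1`, with `∂_σ V = B` on the open
fibre), a bulk `B` (semialgebraic and absolutely integrable on the open prism `A × ℝ × (0,1)`) and an
abscissa-primitive `U` (semialgebraic on the open prism, `∂_τ U = B`, `U → 0` as `τ → ±∞`).
Then the bottom face `[D, V(·,·,0)]` is a relation: Newton–Leibniz along `σ` (rule 3) turns it into
the bulk `[prism, B]` (null faces and the null set `(A×ℝ) \ D` by rule 1), which after the
coordinate permutation `(a,τ,σ) ↦ (a,σ,τ)` and the compactification `τ = (1−ρ)⁻¹ − ρ⁻¹` (rule 2)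
is ONE Newton–Leibniz band along `ρ ∈ [0,1]` over `A × (0,1)` whose primitive `U` vanishes at both
ends (rule 3), i.e. a zero representation. [cite: KontsevichZagier2001, §1.2 rules (1)-(3)] -/
theorem stub_engine :
    ∀ (A : Set ℝ) (D : Set (Fin 2 → ℝ)) (V U B : (Fin 3 → ℝ) → ℝ),
      IsSemialgebraic ℚ {t : Fin 1 → ℝ | t 0 ∈ A} →
      IsSemialgebraic ℚ D →
      D ⊆ {y : Fin 2 → ℝ | y 0 ∈ A} →
      volume ({y : Fin 2 → ℝ | y 0 ∈ A} \ D) = 0 →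
      IsSemialgebraicFunOn ℚ
        {w : Fin 3 → ℝ | (![w 0, w 1] : Fin 2 → ℝ) ∈ D ∧ 0 ≤ w 2 ∧ w 2 ≤ 1} V →
      (∀ y ∈ D, ContinuousOn (fun σ : ℝ => V ![y 0, y 1, σ]) (Icc 0 1) ∧ V ![y 0, y 1, 1] = 0 ∧
        ∀ σ ∈ Ioo (0:ℝ) 1, HasDerivAt (fun σ : ℝ => V ![y 0, y 1, σ]) (B ![y 0, y 1, σ]) σ) →
      IsSemialgebraicFunOn ℚ {w : Fin 3 → ℝ | w 0 ∈ A ∧ 0 < w 2 ∧ w 2 < 1} B →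
      IsSemialgebraicFunOn ℚ {w : Fin 3 → ℝ | w 0 ∈ A ∧ 0 < w 2 ∧ w 2 < 1} U →
      IntegrableOn B {w : Fin 3 → ℝ | w 0 ∈ A ∧ 0 < w 2 ∧ w 2 < 1} →
      (∀ a ∈ A, ∀ σ ∈ Ioo (0:ℝ) 1,
        (∀ τ : ℝ, HasDerivAt (fun τ : ℝ => U ![a, τ, σ]) (B ![a, τ, σ]) τ) ∧
        Tendsto (fun τ : ℝ => U ![a, τ, σ]) atTop (𝓝 0) ∧
        Tendsto (fun τ : ℝ => U ![a, τ, σ]) atBot (𝓝 0)) →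
      ∀ F : KZ.IntegralRep 2, F.domain = D →
        EqOn F.integrand (fun y => V ![y 0, y 1, 0]) D →
        KZ.of F ∈ KZ.relations := by
  intro A D V U B hA hD hDA hnull hV hVfib hB hU hBint hUfib F hFd hFi
  -- the bulk representation `[Ω, B]` on the open prism
  let R : KZ.IntegralRep 3 := ⟨{w : Fin 3 → ℝ | w 0 ∈ A ∧ 0 < w 2 ∧ w 2 < 1}, B,
    Engine.isSemialgebraic_prism hA 0 2, hB, hBint⟩
  exact Engine.of_face_mem_relations_of_bulk A D V B hA hD hDA hnull hV hVfib R rfl rfl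
    (Engine.of_bulk_mem_relations A U B hA hU hUfib R rfl rfl) F hFd hFi

end Summit.KontsevichZagierPeriods.UnfoldedStokes.HyperellipticRiemannRelationLine
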